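import Literature.Topology.FourManifolds.BordismWuNumbers
import Literature.Topology.FourManifolds.BordismFourUnorientedProofs
import Literature.Topology.FourManifolds.BordismFourProjectivePlane
import Literature.AlgebraicTopology.SingularHomology.UniversalCoefficientsField
import Mathlib.SetTheory.Cardinal.Finite
import HarnessLib

/-!
# `|𝔑₄| = 4` from its two halves: Thom's invariants `(χ mod 2, v₁⁴) : 𝔑₄ → (ℤ/2)²`

R. Thom, *Quelques propriétés globales des variétés différentiables*, Comment. Math. Helv. 28
(1954), Thm. IV.9 (p. 76: `𝔑ₖ ≅ (ℤ₂)^{d(k)}`, `d(4) = 2`) and Thm. IV.12 with the generators in small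
dimensions (pp. 79–80): `𝔑⁴ ≅ ℤ₂ + ℤ₂`, the classes being separated by the Stiefel–Whitney numbers
`w₄ = χ mod 2` and `w₁⁴` (Thm. IV.3, Pontryagin: these are bordism invariants; Thm. IV.10: all
Stiefel–Whitney numbers zero ⟹ the manifold bounds), with `PC(2)` (and `PR(4)`) among the
representatives of generators.

This file assembles the target `Literature.Topology.FourManifolds.natCard_unorientedBordismClass_four`
(`Nat.card 𝔑₄ = 4`) from the two halves of that statement, everything else being PROVED in the
tree:

* `UnorientedBordismClass.eulerCharModTwo : 𝔑ₙ → ℤ/2` — `χ mod 2`, well defined by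
  `ClosedSingularManifold.IsBordant.even_eulerChar_sub` (`BordismEulerParity.lean`, Morse theory),
  with `eulerCharModTwo_mk_complexProjectivePlane = 1`;
* `UnorientedBordismClass.thomInvariant = (eulerCharModTwo, wuNumberOnePowFour) : 𝔑₄ → (ℤ/2)²`
  (the second coordinate from `BordismWuNumbers.lean`), with `thomInvariant 0 = (0, 0)` and
  `thomInvariant [ℂℙ²] = (1, 0)` (`wuNumberOnePowFour_complexProjectivePlane`: `H¹(ℂℙ²; ℤ/2) = 0`,
  so `v₁(ℂℙ²) = 0`);
* `natCard_unorientedBordismClass_four_of` — **if some class has `v₁⁴ ≠ 0` (LB: Thom's generator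
  `PR(4)`) and `thomInvariant` is injective (UB: Thm. IV.10 at `k = 4`), then `Nat.card 𝔑₄ = 4`**:
  the classes `0, [ℂℙ²], c, [ℂℙ²] + c` are pairwise distinct by the group laws of `𝔑₄`
  (`bordismFacts_succ`), `[ℂℙ²] ≠ 0` (`unorientedBordismClass_mk_complexProjectivePlane_ne_zero_holds`)
  and the additivity of `v₁⁴`, while an injection into `(ℤ/2)²` bounds the cardinality by `4`.

Neither hypothesis is introduced as a named fact (D-0026): LB needs `H*(ℝℙ⁴; ℤ/2)` with
`Sq¹(a³) = a⁴`, UB is the Pontryagin–Thom computation; both remain to be proved. No `sorry`, no new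
`def … : Prop`.

## References

* R. Thom, *Quelques propriétés globales des variétés différentiables*, Comment. Math. Helv. 28
  (1954), 17–86: Thm. IV.3, IV.9, IV.10, IV.12, pp. 76–80. [ThomCMH1954]
* J. W. Milnor, J. D. Stasheff, *Characteristic Classes* (1974), §4 Thm. 4.9–4.10, Cor. 11.12,
  §17. [MilnorStasheff1974]
-/

noncomputable section

open scoped Manifold ContDiff
open CategoryTheory Set Function
open Literature.AlgebraicTopology.SingularHomology

namespace Literature.Topology.FourManifolds

universe u

/-! ### `χ mod 2` on `𝔑ₙ` -/

section Euler

variable {n : ℕ}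

/-- The Euler characteristic `χ(M) = Σ (-1)ⁱ rank Hᵢ(M; ℤ)` (`i ≤ n`) of the carrier of a closed
singular `n`-manifold, as an integer (the expression of `BordismEulerParity.lean`). [cite: MilnorStasheff1974, §4 Cor. 11.12] -/
def ClosedSingularManifold.intEulerChar {Y : Type*} [TopologicalSpace Y]
    (s : ClosedSingularManifold.{u} Y n) : ℤ :=
  ∑ i ∈ Finset.range (n + 1), (-1 : ℤ) ^ i * (Module.finrank ℤ (singularHomology ℤ ℤ s.M i) : ℤ)

/-- **`χ mod 2 : 𝔑ₙ → ℤ/2`**, well defined because bordant manifolds have Euler characteristics of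
the same parity (`ClosedSingularManifold.IsBordant.even_eulerChar_sub`; Thom 1954 Thm. IV.3 with
`w_n[M] = χ(M) mod 2`, Milnor–Stasheff Cor. 11.12). [cite: ThomCMH1954, Thm. IV.3] [cite: MilnorStasheff1974, §4 Thm. 4.9 and Cor. 11.12] -/
def UnorientedBordismClass.eulerCharModTwo : UnorientedBordismClass.{u} n → ZMod 2 :=
  Quot.lift (fun s => (s.intEulerChar : ZMod 2)) fun s t h => by
    obtain ⟨r, hr⟩ := h.even_eulerChar_sub
    have hr' : s.intEulerChar = t.intEulerChar + (r + r) := by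
      rw [← hr]; unfold ClosedSingularManifold.intEulerChar; ring
    rw [hr']
    push_cast
    rw [CharTwo.add_self_eq_zero, add_zero]

/-- On representatives: `χ₂[M, f] = χ(M) mod 2`. [cite: ThomCMH1954, Thm. IV.3] -/
@[simp]
theorem UnorientedBordismClass.eulerCharModTwo_mk {s : ClosedSingularManifold.{u} PUnit.{u + 1} n} :
    UnorientedBordismClass.eulerCharModTwo (BordismClass.mk s) = (s.intEulerChar : ZMod 2) :=
  rfl

/-- `χ₂[ℂℙ²] = 1` (`χ(ℂℙ²) = 3`; `intCast_eulerChar_complexProjectivePlane`). [cite: ThomCMH1954, Thm. IV.12 and pp. 79–80] -/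
theorem UnorientedBordismClass.eulerCharModTwo_mk_complexProjectivePlane :
    UnorientedBordismClass.eulerCharModTwo (UnorientedBordismClass.mk ComplexProjectivePlane :
      UnorientedBordismClass.{0} 4) = 1 :=
  intCast_eulerChar_complexProjectivePlane

/-- `χ₂(0) = 0`. [cite: ThomCMH1954, Ch. IV §1] -/
theorem UnorientedBordismClass.eulerCharModTwo_zero :
    UnorientedBordismClass.eulerCharModTwo (0 : UnorientedBordismClass.{u} n) = 0 := by
  change ((ClosedSingularManifold.empty.{u} PUnit.{u + 1} n).intEulerChar : ZMod 2) = 0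
  unfold ClosedSingularManifold.intEulerChar
  rw [Finset.sum_eq_zero fun i _ => ?_, Int.cast_zero]
  haveI := ModuleCat.subsingleton_of_isZero
    (isZero_singularHomology_of_isEmpty ℤ ℤ (ClosedSingularManifold.empty.{u} PUnit.{u + 1} n).M i)
  rw [Module.finrank_zero_of_subsingleton, Nat.cast_zero, mul_zero]

end Euler

/-! ### `v₁⁴[ℂℙ²] = 0` -/

/-- `v₁(ℂℙ²) = 0`: `H¹(ℂℙ²; ℤ/2) = 0` (simply connected, so `H₁ = 0`, and `H¹ ↪ Hom(H₁, ℤ/2)`).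
[cite: HatcherAT2002, §3.1 Thm. 3.2 and Thm. 2A.1] -/
theorem wuClass_one_complexProjectivePlane : wuClass ComplexProjectivePlane 4 1 = 0 := by
  haveI : Fact (Nat.Prime 2) := ⟨Nat.prime_two⟩
  haveI := ModuleCat.subsingleton_of_isZero
    (ComplexProjectivePlane.isZero_singularHomology_one (ZMod 2) (ZMod 2))
  apply kroneckerPairing_injective_of_field (ZMod 2) ComplexProjectivePlane 1
  ext c
  rw [Subsingleton.elim c 0, map_zero, map_zero]

/-- **`v₁⁴[ℂℙ²] = 0`** (Thom 1954, pp. 79–80: `PC(2)` has `w₁ = 0`). [cite: ThomCMH1954, Thm. IV.12 and pp. 79–80] -/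
theorem wuNumberOnePowFour_complexProjectivePlane : wuNumberOnePowFour ComplexProjectivePlane = 0 := by
  rw [wuNumberOnePowFour, wuClassOnePowFour, wuClass_one_complexProjectivePlane]
  simp only [map_zero, LinearMap.zero_apply]

/-! ### Thom's invariant `(χ mod 2, v₁⁴) : 𝔑₄ → (ℤ/2)²` -/

/-- **Thom's invariant `(χ mod 2, v₁⁴[·]) : 𝔑₄ → ℤ/2 × ℤ/2`** — by Thm. IV.12 (pp. 79–80) an
isomorphism `𝔑⁴ ≅ ℤ₂ + ℤ₂`; here only a well-defined map (bijectivity is the content of the two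
hypotheses of `natCard_unorientedBordismClass_four_of`). [cite: ThomCMH1954, Thm. IV.9, Thm. IV.12] -/
def UnorientedBordismClass.thomInvariant (a : UnorientedBordismClass.{u} 4) : ZMod 2 × ZMod 2 :=
  (UnorientedBordismClass.eulerCharModTwo a, UnorientedBordismClass.wuNumberOnePowFour a)

/-- `thomInvariant 0 = (0, 0)`. [cite: ThomCMH1954, Ch. IV §1] -/
theorem UnorientedBordismClass.thomInvariant_zero :
    UnorientedBordismClass.thomInvariant (0 : UnorientedBordismClass.{u} 4) = (0, 0) :=
  Prod.ext UnorientedBordismClass.eulerCharModTwo_zero UnorientedBordismClass.wuNumberOnePowFour_zero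

/-- `thomInvariant [ℂℙ²] = (1, 0)`. [cite: ThomCMH1954, Thm. IV.12 and pp. 79–80] -/
theorem UnorientedBordismClass.thomInvariant_mk_complexProjectivePlane :
    UnorientedBordismClass.thomInvariant (UnorientedBordismClass.mk ComplexProjectivePlane :
      UnorientedBordismClass.{0} 4) = (1, 0) :=
  Prod.ext UnorientedBordismClass.eulerCharModTwo_mk_complexProjectivePlane
    wuNumberOnePowFour_complexProjectivePlane

/-! ### The count -/

/-- **`|𝔑₄| = 4` from its two halves.**  Assume (LB) some class `c ∈ 𝔑₄` has `v₁⁴(c) = 1`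
(Thom 1954, pp. 79–80: `PR(4)`), and (UB) Thom's invariant `(χ mod 2, v₁⁴)` is injective on `𝔑₄`
(Thm. IV.10 at `k = 4` with the relations among Stiefel–Whitney numbers of 4-manifolds).  Then
`Nat.card 𝔑₄ = 4`: the classes `0, [ℂℙ²], c, [ℂℙ²] + c` are pairwise distinct — `[ℂℙ²] ≠ 0`
(`unorientedBordismClass_mk_complexProjectivePlane_ne_zero_holds`), `v₁⁴[ℂℙ²] = 0 ≠ 1 = v₁⁴(c) =
v₁⁴([ℂℙ²] + c)` (additivity), and `[ℂℙ²] + c = c` would force `[ℂℙ²] = 0` (`a + a = 0` in `𝔑₄`) — so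
`4 ≤ |𝔑₄|`, while the injection into `(ℤ/2)²` gives `|𝔑₄| ≤ 4`. [cite: ThomCMH1954, Thm. IV.9 (p. 76), Thm. IV.12 and pp. 79–80] -/
theorem natCard_unorientedBordismClass_four_of
    (hLB : ∃ c : UnorientedBordismClass.{0} 4, UnorientedBordismClass.wuNumberOnePowFour c = 1)
    (hUB : Function.Injective (UnorientedBordismClass.thomInvariant : UnorientedBordismClass.{0} 4 → _)) :
    natCard_unorientedBordismClass_four := by
  unfold natCard_unorientedBordismClass_four
  haveI := ClosedSingularManifold.bordismFacts_succ (Y := PUnit.{1}) (n := 3)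
  obtain ⟨c, hc⟩ := hLB
  set b : UnorientedBordismClass.{0} 4 := UnorientedBordismClass.mk ComplexProjectivePlane with hbdef
  have hb0 : b ≠ 0 := unorientedBordismClass_mk_complexProjectivePlane_ne_zero_holds
  have hvb : UnorientedBordismClass.wuNumberOnePowFour b = 0 :=
    wuNumberOnePowFour_complexProjectivePlane
  have hv0 : UnorientedBordismClass.wuNumberOnePowFour (0 : UnorientedBordismClass.{0} 4) = 0 :=
    UnorientedBordismClass.wuNumberOnePowFour_zero
  have hvbc : UnorientedBordismClass.wuNumberOnePowFour (b + c) = 1 := by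
    rw [UnorientedBordismClass.wuNumberOnePowFour_add, hvb, hc, zero_add]
  -- finiteness and the upper bound from the injection into `(ℤ/2)²`
  haveI : Finite (UnorientedBordismClass.{0} 4) := Finite.of_injective _ hUB
  letI : Fintype (UnorientedBordismClass.{0} 4) := Fintype.ofFinite _
  have hle : Nat.card (UnorientedBordismClass.{0} 4) ≤ 4 := by
    have h := Nat.card_le_card_of_injective _ hUB
    rw [Nat.card_prod, Nat.card_zmod] at h
    exact h
  -- four pairwise distinct classes
  have h01 : (0 : UnorientedBordismClass.{0} 4) ≠ b := fun h => hb0 h.symm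
  have h02 : (0 : UnorientedBordismClass.{0} 4) ≠ c := fun h => by
    rw [← h, hv0] at hc; exact zero_ne_one hc
  have h03 : (0 : UnorientedBordismClass.{0} 4) ≠ b + c := fun h => by
    rw [← h, hv0] at hvbc; exact zero_ne_one hvbc
  have h12 : b ≠ c := fun h => by
    rw [h, hc] at hvb; exact one_ne_zero hvb
  have h13 : b ≠ b + c := fun h => by
    rw [← h, hvb] at hvbc; exact zero_ne_one hvbc
  have h23 : c ≠ b + c := fun h => by
    apply hb0
    have h' : b + c + c = c + c := by rw [← h]
    rwa [BordismClass.add_assoc, BordismClass.add_self_eq_zero, BordismClass.add_zero] at h'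
  have hge : 4 ≤ Nat.card (UnorientedBordismClass.{0} 4) := by
    classical
    have hs : ({0, b, c, b + c} : Finset (UnorientedBordismClass.{0} 4)).card = 4 := by
      rw [Finset.card_insert_of_notMem (by simp [h01, h02, h03]),
        Finset.card_insert_of_notMem (by simp [h12, h13]),
        Finset.card_insert_of_notMem (by simp [h23]), Finset.card_singleton]
    have hu := Finset.card_le_univ ({0, b, c, b + c} : Finset (UnorientedBordismClass.{0} 4))
    rw [hs] at hu
    rw [Nat.card_eq_fintype_card]
    exact hu
  omega

end Literature.Topology.FourManifolds
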